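import Literature.NumberTheory.Automorphic.ResGLnCuspidalEigenclassOfClean
import Literature.NumberTheory.Automorphic.ResGLnCuspidalEigenclassOfConeFamily
import Literature.NumberTheory.Automorphic.ResGLnHermitianConeOpen
import Literature.NumberTheory.Automorphic.ResGLnConeDictionaryCone
import Literature.NumberTheory.Automorphic.HeckeLocalSumFixedRepresentative
import Literature.NumberTheory.Automorphic.ArithmeticQuotientHeckeLocal
import Literature.NumberTheory.Automorphic.CompletedCohomologyHeckeAlgebraGLnHolds
import Literature.NumberTheory.Automorphic.UnramifiedLevelChange
import HarnessLib

/-!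
# The cone form of a level-fixed cochain is a Hecke eigenfamily in the finite variable — crux
HeckeEigenvalueField (stmt-Langlands-13632), line Sketch, stub (b3) `stub_coneForm_hecke`

Statement.  Let `π = W / W'` be a cuspidal automorphic representation of `GL_n(𝔸_K)` with
`W' = ⊥`, `𝔫 ≠ 0` an ideal of `𝓞 K`, `η` a `(q + 1)`-cochain of the `(𝔤, K_∞)`-complex of
`W ⊗ (E_λ(ℂ) ⊗ ε_S)` whose values are fixed by `r(u) ⊗ 1`, `u ∈ K_f(𝔫)`
(`ConeDictionary.IsLevelFixed`), and `c : v ↦ i ↦ c_{v,i}` the EXACT eigenvalues of the double coset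
operators `T_{v,i}(ϖ_v) = [K(𝔫) t_{v,i} K(𝔫)]`, `v ∤ 𝔫`, `i ≤ n`, on the `K(𝔫)`-invariants of `W`
(hypothesis `hc`).  Then the cone form `c' ↦ ω_{c'}(y)(vec) = ConeDictionary.coneForm π S λ η c' y vec`
(an `E_λ(ℂ)`-valued function of the finite-adelic variable, read on `GL_n(𝔸_K^∞) / K_f(𝔫)` through
`Quotient.out`) is an eigenfunction of the double coset operator
`ArithmeticQuotient.heckeFun ℂ K_f(𝔫) t_{v,i}` with the eigenvalue `c_{v,i}`.

Proof.  (1) The level `K_f(𝔫)` is unramified at `v ∤ 𝔫`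
(`BigHeckeGLn.isUnramifiedLevel_comap_principalCongruenceLevel`) and `t_{v,i} = ι_v(diag(ϖ_v^{(i)}, 1))`
(`BigHeckeGLn.heckeElement_eq_ofLocal`), so the global double coset sum is the local one
(`ArithmeticQuotient.IsUnramifiedLevel.heckeFun_apply_eq_sum_local`):
`(T f)(c K_f) = ∑_{y K_v ⊆ K_v t K_v} f(c ι_v(y) K_f)`.  (2) The family only depends on the coset
(`ConeDictionary.coneForm_mul_of_isLevelFixed`), and unfolding the dictionary
(`coneForm = E(g) · evalTensor θ (g, c')` with the SAME `g = sec y ∈ G_∞` and the SAME level-fixed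
tensor `θ = η(X) ∈ W ⊗ E` for every `c'`), `(g, c ι_v(y)) = (g, c) · ι_v(y)`
(`ConeDictionary.adelicPt_mul_right`, `GLn.ofFinite_sndHom_ofLocal`), the claim becomes
`∑_y evalTensor θ (x ι_v(y)) = c_{v,i} • evalTensor θ x` in `E` after pulling the finite sum through
the linear map `E(g)`.  (3) SCALARISATION: for a linear functional `ℓ` on `E` the coordinate
`x ↦ ℓ(evalTensor θ x)` is an honest `K(𝔫)`-INVARIANT element of `W` (induction on the tensor
product; `K(𝔫) = GLn.ofFinite (K_f(𝔫))`, `map_ofFinite_finitePrincipalCongruenceLevel`,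
`evalTensor_rTensor_finiteRepW`), on which the local coset sum `∑_y r(ι_v y)` IS the classical Hecke
operator `[K(𝔫) t_{v,i}(ϖ_v) K(𝔫)]` (`AutomorphicRepData.sum_rightTranslation_ofLocal_eq_heckeOperator`,
`heckeDiagAt_eq_ofLocal_glDiagonal`), which acts by `c_{v,i}` by `hc`; as the linear functionals
separate the points of `E` (`Module.forall_dual_apply_eq_zero_iff`), the vector identity follows.
(The cleanness hypothesis `W' = ⊥` of the registered signature is not needed: `hc` already gives the
EXACT eigenvalues on all of `W^{K(𝔫)}`, and the scalar coordinates of `θ` are such forms.)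
Flath 1979, Thm. 3; Harder 1987, §3; Khare–Thorne 2017, §6.2.

Namespace `Summit.Langlands.Langlands.Theorems.HeckeEigenvalueField.Res` (the line's namespace); theorems
only (no named fact, no `sorry`); a `--supports` helper for the registered stub `stub_coneForm_hecke` of
`Cruxes/HeckeEigenvalueField/Lines/Sketch.lean` (v12), stated byte-identically.
-/

set_option linter.dupNamespace false -- project-wide: `Summit.Langlands.Langlands` is the mandated namespace

noncomputable section

open scoped Classical TensorProduct
open NumberField NumberField.mixedEmbedding IsDedekindDomain
open Literature.NumberTheory.Automorphic

namespace Summit.Langlands.Langlands.Theorems.HeckeEigenvalueField.Res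

open ResGLnCohomology BigHeckeGLn

/-! ### Scalar coordinates of a tensor `θ ∈ W ⊗ E` -/

/-- **The scalar coordinates of an evaluated tensor are forms of `W`**: for `t ∈ W ⊗_ℂ E` and a
linear functional `ℓ` on `E`, `x ↦ ℓ (t(x))` (`t(x) = evalTensor t x`, `(ψ ⊗ e)(x) = ψ(x) e`) lies in
`W` (a finite sum of scalar multiples of elements of `W`). [cite: BorelWallach2000, VII 2.2] -/
theorem apply_evalTensor_mem_W {n : ℕ} {K : Type} [Field K] [NumberField K]
    {hcpt : isCompact_glFiniteIntegralLevel n K} (π : AutomorphicRepData (AutomorphyDatum.gl n K hcpt))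
    {E : Type*} [AddCommGroup E] [Module ℂ E] (ℓ : E →ₗ[ℂ] ℂ) (t : π.W ⊗[ℂ] E) :
    (fun z => ℓ (π.evalTensor E t z)) ∈ π.W := by
  induction t using TensorProduct.induction_on with
  | zero =>
    have h0 : (fun z => ℓ (π.evalTensor E 0 z)) = 0 := by
      funext z
      simp only [map_zero, Pi.zero_apply]
    rw [h0]
    exact π.W.zero_mem
  | tmul ψ e =>
    have h1 : (fun z => ℓ (π.evalTensor E (ψ ⊗ₜ[ℂ] e) z)) =
        (ℓ e) • (ψ : (AdelicGroupData.gl n K).Adelic → ℂ) := by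
      funext z
      rw [AutomorphicRepData.evalTensor_tmul, map_smul, smul_eq_mul, Pi.smul_apply, smul_eq_mul, mul_comm]
    rw [h1]
    exact π.W.smul_mem _ ψ.2
  | add t t' ht ht' =>
    have h2 : (fun z => ℓ (π.evalTensor E (t + t') z)) =
        (fun z => ℓ (π.evalTensor E t z)) + fun z => ℓ (π.evalTensor E t' z) := by
      funext z
      simp only [map_add, Pi.add_apply]
    rw [h2]
    exact π.W.add_mem ht ht'

/-- **The scalar coordinates of a `K_f(𝔫)`-fixed tensor are `K(𝔫)`-invariant**: if
`(r(u) ⊗ 1) θ = θ` for all `u ∈ K_f(𝔫)`, then `x ↦ ℓ (θ(x))` is right `K(𝔫)`-invariant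
(`K(𝔫) = {1} × K_f(𝔫)`, and `((r(h) ⊗ 1) θ)(x) = θ(x h)`). [cite: BorelJacquetCorvallis1979, §4.6] -/
theorem rightTranslation_apply_evalTensor_eq_of_fixed {n : ℕ} {K : Type} [Field K] [NumberField K]
    {hcpt : isCompact_glFiniteIntegralLevel n K} (π : AutomorphicRepData (AutomorphyDatum.gl n K hcpt))
    {E : Type*} [AddCommGroup E] [Module ℂ E] (ℓ : E →ₗ[ℂ] ℂ) {𝔫 : Ideal (𝓞 K)} {θ : π.W ⊗[ℂ] E}
    (hθ : ∀ u : FiniteAdelicGL n K, u ∈ level n K 𝔫 →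
      (π.finiteRepW ⟨GLn.ofFinite n K u, u, rfl⟩).rTensor E θ = θ) :
    ∀ u ∈ principalCongruenceLevel n K 𝔫,
      rightTranslation (AdelicGroupData.gl n K) u (fun z => ℓ (π.evalTensor E θ z)) =
        fun z => ℓ (π.evalTensor E θ z) := by
  intro u hu
  have hu1 : u ∈ (finitePrincipalCongruenceLevel n K 𝔫).map (GLn.ofFinite n K) := by
    rw [map_ofFinite_finitePrincipalCongruenceLevel]
    exact hu
  obtain ⟨u', hu', rfl⟩ := Subgroup.mem_map.1 hu1
  funext z
  rw [rightTranslation_apply]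
  have h := congrArg (fun t => ℓ (π.evalTensor E t z)) (hθ u' hu')
  simp only [AutomorphicRepData.evalTensor_rTensor_finiteRepW] at h
  exact h

/-- The `Quotient.out` representatives of a finite set of cosets `S ⊆ G / H` form a transversal of `S`
(the shape in which double coset operators are summed). [cite: Shimura1971, Prop. 3.1]
[cite: Cartier1979, §IV] -/
theorem bijOn_image_out {G : Type*} [Group G] [DecidableEq G] (H : Subgroup G) {S : Set (G ⧸ H)}
    (hS : S.Finite) :
    Set.BijOn (fun y : G => (y : G ⧸ H)) (hS.toFinset.image Quotient.out) S := by
  refine ⟨?_, ?_, ?_⟩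
  · rintro _ hy
    rw [Finset.coe_image, Set.mem_image] at hy
    obtain ⟨c, hc, rfl⟩ := hy
    rw [Finset.mem_coe, Set.Finite.mem_toFinset] at hc
    dsimp only
    rwa [QuotientGroup.out_eq']
  · rintro y₁ hy₁ y₂ hy₂ hxy
    rw [Finset.coe_image, Set.mem_image] at hy₁ hy₂
    obtain ⟨c₁, -, rfl⟩ := hy₁
    obtain ⟨c₂, -, rfl⟩ := hy₂
    dsimp only at hxy
    rw [QuotientGroup.out_eq', QuotientGroup.out_eq'] at hxy
    rw [hxy]
  · intro c hc
    refine ⟨c.out, ?_, QuotientGroup.out_eq' c⟩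
    rw [Finset.coe_image, Set.mem_image]
    exact ⟨c, by rwa [Finset.mem_coe, Set.Finite.mem_toFinset], rfl⟩

/-! ### The local coset sum on a level-fixed tensor -/

/-- **The local coset sum acts on a `K_f(𝔫)`-fixed tensor `θ ∈ W ⊗ E` by the exact Hecke
eigenvalue.**  If `T_{v,i}(ϖ_v) = [K(𝔫) t_{v,i}(ϖ_v) K(𝔫)]` acts by the scalar `c_{v,i}` on every
`K(𝔫)`-invariant form of `W` (`v ∤ 𝔫`, `𝔫 ≠ 0`), then at every adelic point `(g, c)`
(`ConeDictionary.adelicPt`), `∑_{y K_v ⊆ K_v t_{v,i} K_v} θ(g, c ι_v(y)) = c_{v,i} • θ(g, c)` in `E`: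
on each scalar coordinate `x ↦ ℓ(θ(x)) ∈ W^{K(𝔫)}` the local sum of right translations is the
classical Hecke operator (local–global coset correspondence at the unramified level `K_f(𝔫)`,
`(g, c ι_v(y)) = (g, c) · ι_v(y)`), and the linear functionals separate the points of `E`.
[cite: FlathCorvallis1979, Thm. 3] [cite: KhareThorne2017, §6.2] [cite: Harder1987, §3] -/
theorem sum_evalTensor_adelicPt_mul_ofLocal_eq_smul {n : ℕ} {K : Type} [Field K] [NumberField K]
    {hcpt : isCompact_glFiniteIntegralLevel n K} (π : AutomorphicRepData (AutomorphyDatum.gl n K hcpt))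
    {E : Type*} [AddCommGroup E] [Module ℂ E]
    {𝔫 : Ideal (𝓞 K)} (h𝔫 : 𝔫 ≠ 0) {v : HeightOneSpectrum (𝓞 K)} (hv : ¬ v.asIdeal ∣ 𝔫) {i : ℕ} {cvi : ℂ}
    (hc : ∀ ψ ∈ π.W,
      (∀ u ∈ principalCongruenceLevel n K 𝔫, rightTranslation (AdelicGroupData.gl n K) u ψ = ψ) →
      heckeOperator (rightTranslation (AdelicGroupData.gl n K)) (principalCongruenceLevel n K 𝔫)
        (heckeDiagAt n K v (uniformizerAt v) i) ψ = cvi • ψ)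
    {θ : π.W ⊗[ℂ] E}
    (hθ : ∀ u : FiniteAdelicGL n K, u ∈ level n K 𝔫 →
      (π.finiteRepW ⟨GLn.ofFinite n K u, u, rfl⟩).rTensor E θ = θ)
    (ha : (MulAction.orbit (valuedCongruenceSubgroup (Fin n) (1 : WithZero (Multiplicative ℤ)) :
          Subgroup (GL (Fin n) (v.adicCompletion K)))
        ((glDiagonal n (v.adicCompletion K) fun l => if l.val < i then uniformizerAt v else 1 :
            GL (Fin n) (v.adicCompletion K)) :
          GL (Fin n) (v.adicCompletion K) ⧸
            (valuedCongruenceSubgroup (Fin n) (1 : WithZero (Multiplicative ℤ)) :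
              Subgroup (GL (Fin n) (v.adicCompletion K))))).Finite)
    (g : (AutomorphyDatum.gl n K hcpt).arch.carrier) (c : FiniteAdelicGL n K) :
    ∑ yy ∈ ha.toFinset,
        π.evalTensor E θ (ConeDictionary.adelicPt hcpt g (c * BigHeckeGLn.ofLocal n K v yy.out)) =
      cvi • π.evalTensor E θ (ConeDictionary.adelicPt hcpt g c) := by
  -- the scalar coordinates of `θ`: honest `K(𝔫)`-invariant forms of `W`
  have hW : ∀ ℓ : E →ₗ[ℂ] ℂ, (fun z => ℓ (π.evalTensor E θ z)) ∈ π.W := fun ℓ =>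
    apply_evalTensor_mem_W π ℓ θ
  have hWfix : ∀ ℓ : E →ₗ[ℂ] ℂ, ∀ u ∈ principalCongruenceLevel n K 𝔫,
      rightTranslation (AdelicGroupData.gl n K) u (fun z => ℓ (π.evalTensor E θ z)) =
        fun z => ℓ (π.evalTensor E θ z) := fun ℓ =>
    rightTranslation_apply_evalTensor_eq_of_fixed π ℓ hθ
  -- the `Quotient.out` transversal of the local double coset
  have hs := bijOn_image_out
    (valuedCongruenceSubgroup (Fin n) (1 : WithZero (Multiplicative ℤ)) :
      Subgroup (GL (Fin n) (v.adicCompletion K))) ha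
  have hinj : ∀ a ∈ ha.toFinset, ∀ b ∈ ha.toFinset, a.out = b.out → a = b := fun a _ b _ hab => by
    rw [← QuotientGroup.out_eq' a, ← QuotientGroup.out_eq' b, hab]
  -- scalarise
  rw [← sub_eq_zero]
  refine (Module.forall_dual_apply_eq_zero_iff ℂ _).1 fun ℓ => ?_
  -- on the coordinate `ℓ ∘ θ` the local sum is the classical Hecke operator, i.e. the scalar `cvi`
  have h1 := AutomorphicRepData.sum_rightTranslation_ofLocal_eq_heckeOperator h𝔫 hv
    (glDiagonal n (v.adicCompletion K) fun l => if l.val < i then uniformizerAt v else 1) _ hs (hWfix ℓ)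
  rw [← heckeDiagAt_eq_ofLocal_glDiagonal, hc _ (hW ℓ) (hWfix ℓ)] at h1
  -- `ι_v(y) = (1, ι_v(y)_f)`
  have h1' : ∑ y ∈ ha.toFinset.image Quotient.out,
      rightTranslation (AdelicGroupData.gl n K) (GLn.ofFinite n K (BigHeckeGLn.ofLocal n K v y))
        (fun z => ℓ (π.evalTensor E θ z)) =
      cvi • fun z => ℓ (π.evalTensor E θ z) :=
    (Finset.sum_congr rfl fun y _ =>
      congrArg (fun g' => rightTranslation (AdelicGroupData.gl n K) g' fun z => ℓ (π.evalTensor E θ z))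
        (GLn.ofFinite_sndHom_ofLocal v y)).trans h1
  have h2 := congrFun h1' (ConeDictionary.adelicPt hcpt g c)
  rw [Finset.sum_apply, Finset.sum_image hinj, Pi.smul_apply, smul_eq_mul] at h2
  simp only [rightTranslation_apply] at h2
  rw [map_sub, map_sum, map_smul, smul_eq_mul, sub_eq_zero]
  simp only [ConeDictionary.adelicPt_mul_right]
  exact h2

/-! ### The cone form in closed form and the stub -/

/-- **The cone form in closed form**: `ω_c(H)(v₁, …) = E(g) · θ(g, c)` with `g = sec H` read in
`G_∞` and the tensor `θ = η(g⁻¹ · ½ v₁ g⁻ᴴ, …) ∈ W ⊗ E` (which depends on `H` and the `vᵢ` only)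
evaluated at the adelic point `(g, c)` (all the dictionary's unfolding lemmas are definitional).
[cite: BorelWallach2000, VII 2.2–2.5] -/
theorem coneForm_eq_σS_evalTensor {n : ℕ} {K : Type} [Field K] [NumberField K]
    {hcpt : isCompact_glFiniteIntegralLevel n K} (π : AutomorphicRepData (AutomorphyDatum.gl n K hcpt))
    (S : Finset {w : InfinitePlace K // w.IsReal}) (lam : (K →+* ℂ) → Fin n → ℤ) {q : ℕ}
    (η : ConeDictionary.Cochain π lam q) (c : FiniteAdelicGL n K) (H : ResGLnCone.hermSpace n K)
    (w : Fin q → ResGLnCone.hermSpace n K) :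
    ConeDictionary.coneForm π S lam η c H w =
      ConeDictionary.σS hcpt S lam (GLn.archOfMatrix n K (ConeDictionary.sec n K H))
        (π.evalTensor (CoeffModule ℂ n K lam)
          (@id (π.W ⊗[ℂ] CoeffModule ℂ n K lam)
            (η fun j => ConeDictionary.toLie n K hcpt
              (Ring.inverse (ConeDictionary.sec n K H) *
                ConeDictionary.halfRight n K (ConeDictionary.sec n K H) (w j))))
          (ConeDictionary.adelicPt hcpt (GLn.archOfMatrix n K (ConeDictionary.sec n K H)) c)) :=
  rfl

/-- **Stub (b3) HECKE: the cone form of a level-fixed cochain of a CLEAN `π` is an eigenfamily of the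
double coset operators in the finite variable**, with the eigenvalues `c_{v,i}` of `T_{v,i}(ϖ_v)` on
`π^{K(𝔫)}` (`v ∤ 𝔫`, `i ≤ n`): the global double coset `K_f(𝔫) t_{v,i} K_f(𝔫)` is the local one at the
unramified place (`BigHeckeGLn.isUnramifiedLevel_comap_principalCongruenceLevel`,
`ArithmeticQuotient.IsUnramifiedLevel.heckeFun_apply_eq_sum_local`, `BigHeckeGLn.heckeElement_eq_ofLocal`,
`GLn.ofFinite_sndHom_ofLocal`), right `K_f(𝔫)`-invariance of the family
(`ConeDictionary.coneForm_mul_of_isLevelFixed`), `ω(c · x) = E(s) θ((s, c) · x)`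
(`ConeDictionary.adelicPt_mul_right`), and on the scalar coordinates of the level-fixed tensor `θ`
(honest `K(𝔫)`-invariant forms of `W`) the local coset sum is the classical Hecke operator
`[K(𝔫) t_{v,i}(ϖ_v) K(𝔫)]`, which acts by `c_{v,i}` (`hc`); linear functionals separate points.
[cite: FlathCorvallis1979, Thm. 3] [cite: Clozel1990, §3.5 (p. 123)] [cite: Harder1987, §3]
[cite: KhareThorne2017, §6.2] -/
theorem stub_coneForm_hecke {n : ℕ} {K : Type} [Field K] [NumberField K]
    (hcpt : isCompact_glFiniteIntegralLevel n K) (𝔫 : Ideal (𝓞 K)) (h𝔫 : 𝔫 ≠ 0)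
    (π : CuspidalAutomorphicRepData n K hcpt) (hbot : π.1.W' = ⊥)
    (S : Finset {w : InfinitePlace K // w.IsReal}) (lam : (K →+* ℂ) → Fin n → ℤ) {q : ℕ}
    (η : ConeDictionary.Cochain π.1 lam (q + 1)) (hfix : ConeDictionary.IsLevelFixed π.1 lam 𝔫 η)
    (c : HeightOneSpectrum (𝓞 K) → ℕ → ℂ)
    (hc : ∀ v : HeightOneSpectrum (𝓞 K), ¬ v.asIdeal ∣ 𝔫 → ∀ i ≤ n, ∀ ψ ∈ π.1.W,
      (∀ u ∈ principalCongruenceLevel n K 𝔫, rightTranslation (AdelicGroupData.gl n K) u ψ = ψ) →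
      heckeOperator (rightTranslation (AdelicGroupData.gl n K)) (principalCongruenceLevel n K 𝔫)
        (heckeDiagAt n K v (uniformizerAt v) i) ψ = c v i • ψ)
    {v : HeightOneSpectrum (𝓞 K)} (hv : ¬ v.asIdeal ∣ 𝔫) {i : ℕ} (hi : i ≤ n)
    (cL : FiniteAdelicGL n K ⧸ level n K 𝔫) (y : ResGLnCone.hermSpace n K)
    (vec : Fin (q + 1) → ResGLnCone.hermSpace n K) :
    ArithmeticQuotient.heckeFun ℂ (level n K 𝔫) (heckeElement n K v i) (CoeffModule ℂ n K lam)
        (fun c' => ConeDictionary.coneForm π.1 S lam η c'.out y vec) cL =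
      c v i • ConeDictionary.coneForm π.1 S lam η cL.out y vec := by
  -- cleanness `hbot` is part of the registered signature but is not used: `hc` gives the EXACT
  -- eigenvalues on all of `W^{K(𝔫)}`, which is everything the scalarisation below needs
  have _ := hbot
  -- (1) global → local double coset at the unramified place `v`
  have hunr : ArithmeticQuotient.IsUnramifiedLevel
      (valuedCongruenceSubgroup (Fin n) (1 : WithZero (Multiplicative ℤ)) :
        Subgroup (GL (Fin n) (v.adicCompletion K)))
      (BigHeckeGLn.ofLocal n K v) (BigHeckeGLn.localComponent n K v) (level n K 𝔫) :=
    BigHeckeGLn.isUnramifiedLevel_comap_principalCongruenceLevel (n := n) (K := K) h𝔫 hv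
  have ha : (MulAction.orbit (valuedCongruenceSubgroup (Fin n) (1 : WithZero (Multiplicative ℤ)) :
          Subgroup (GL (Fin n) (v.adicCompletion K)))
        ((glDiagonal n (v.adicCompletion K) fun l => if l.val < i then uniformizerAt v else 1 :
            GL (Fin n) (v.adicCompletion K)) :
          GL (Fin n) (v.adicCompletion K) ⧸
            (valuedCongruenceSubgroup (Fin n) (1 : WithZero (Multiplicative ℤ)) :
              Subgroup (GL (Fin n) (v.adicCompletion K))))).Finite := by
    haveI := isHeckeTriple_top_of_isCompact_isOpen _
      (isCompact_valuedCongruenceSubgroup_one n K v) (isOpen_valuedCongruenceSubgroup_one n K v)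
    exact finite_orbit_quotient _ _
  conv_lhs => rw [← QuotientGroup.out_eq' cL, BigHeckeGLn.heckeElement_eq_ofLocal]
  rw [hunr.heckeFun_apply_eq_sum_local ha]
  -- (2) representative invariance of the family under the level
  have hA : ∀ yy : GL (Fin n) (v.adicCompletion K) ⧸
      (valuedCongruenceSubgroup (Fin n) (1 : WithZero (Multiplicative ℤ)) :
        Subgroup (GL (Fin n) (v.adicCompletion K))),
      ConeDictionary.coneForm π.1 S lam η
          (((cL.out * BigHeckeGLn.ofLocal n K v yy.out : FiniteAdelicGL n K) :
            FiniteAdelicGL n K ⧸ level n K 𝔫)).out y vec =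
        ConeDictionary.coneForm π.1 S lam η (cL.out * BigHeckeGLn.ofLocal n K v yy.out) y vec := by
    intro yy
    obtain ⟨u, hu⟩ := QuotientGroup.mk_out_eq_mul (level n K 𝔫) (cL.out * BigHeckeGLn.ofLocal n K v yy.out)
    rw [hu, ConeDictionary.coneForm_mul_of_isLevelFixed π.1 S lam hfix _ u.2]
  simp only [hA, coneForm_eq_σS_evalTensor]
  -- (3) the level-fixed tensor `θ = η(X)` and the scalar action of the local coset sum on it
  have hθ : ∀ u : FiniteAdelicGL n K, u ∈ level n K 𝔫 →
      (π.1.finiteRepW ⟨GLn.ofFinite n K u, u, rfl⟩).rTensor (CoeffModule ℂ n K lam)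
          (@id (π.1.W ⊗[ℂ] CoeffModule ℂ n K lam)
            (η fun j => ConeDictionary.toLie n K hcpt
              (Ring.inverse (ConeDictionary.sec n K y) *
                ConeDictionary.halfRight n K (ConeDictionary.sec n K y) (vec j)))) =
        @id (π.1.W ⊗[ℂ] CoeffModule ℂ n K lam)
          (η fun j => ConeDictionary.toLie n K hcpt
            (Ring.inverse (ConeDictionary.sec n K y) *
              ConeDictionary.halfRight n K (ConeDictionary.sec n K y) (vec j))) :=
    fun u hu => hfix _ u hu
  have hstar := sum_evalTensor_adelicPt_mul_ofLocal_eq_smul π.1 h𝔫 hv (hc v hv i hi) hθ ha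
    (GLn.archOfMatrix n K (ConeDictionary.sec n K y)) cL.out
  -- (4) pull the finite sum and the scalar through the linear map `E(g)`
  rw [← map_sum]
  exact (congrArg (ConeDictionary.σS hcpt S lam _) hstar).trans (map_smul _ _ _)

end Summit.Langlands.Langlands.Theorems.HeckeEigenvalueField.Res

end
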